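import Summits.NavierStokesRegularity.NavierStokesRegularity.Theorems.EulerZoomLiouvillePowerGaugeEulerLiouvilleNeedleSphereSlices

/-!
# Reverse cone Tonelli: the volume of a cone sector is controlled by the chart discs
# (plate t39c-A of ROUND-38 «the waiting-time exponent»; crux E `PowerGaugeEulerLiouville`,
# stmt-NavierStokesRegularity-19832)

LANDING PLATE prepared by nsreg-p2 g33 (TEXT custody, DIRECTOR-NS #199 (1)) for a keyed PROVER hand
(`--supports stmt-NavierStokesRegularity-19832 --as helper`).  No Euler content.

ROUND-36's cone Tonelli (`NeedleSphereThinness.lintegral_cone_le`) bounds the iterated chart integral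
`∫_{t ∈ I} ∫_{‖z‖ < θt} g(Φ_t z) dz dt` by the volume integral `∫ g` (the cone map has Jacobian `t/h ≥ 1`).
The race needs the REVERSE direction — the VOLUME of the fast tube from the AREA of the fast set in the
charts: on the aperture-`θ` cone the Jacobian is also `≤ 1/√(1 − θ²)`, whence

* `lintegral_sector_le`: for measurable `g ≥ 0`, measurable positive radii `I`, `0 < θ < 1`,
  `∫_{sector e I θ} g ≤ (1/√(1−θ²)) · ∫_{t ∈ I} ∫_{‖z‖ < θt} g (sphereChart e e₁ e₂ t z) dz dt`,
  `sector e I θ = {y : ‖y‖ ∈ I, ⟪y, e⟫ > √(1−θ²) ‖y‖}`;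
* `mem_sector_of_inner_sq`: the closed `1/√3`-cone of `e` (minus the origin) lies in the sector of every
  aperture `θ` with `θ² > 2/3` — so the SIX signed frame directions cover `ℝ³ ∖ {0}` (with
  `NeedleSphereChart.exists_inner_sq_ge`).
[folklore: Tonelli, one-dimensional change of variables]
-/

set_option linter.dupNamespace false

open MeasureTheory Set Metric Real
open scoped RealInnerProductSpace ENNReal

namespace Summit.NavierStokesRegularity.NavierStokesRegularity.Theorems.PowerGaugeEulerLiouville.NeedleSectorTonelli

open NeedleDiscChart NeedleSphereChart NeedleThinness NeedleSphereThinness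

variable {e e₁ e₂ : (EuclideanSpace ℝ (Fin 3))}

/-- The open cone SECTOR of aperture `θ` about `e` over the radii `I`:
`{y : ‖y‖ ∈ I, √(1 − θ²) ‖y‖ < ⟪y, e⟫}`. -/
def sector (e : (EuclideanSpace ℝ (Fin 3))) (I : Set ℝ) (θ : ℝ) : Set (EuclideanSpace ℝ (Fin 3)) :=
  (fun y : (EuclideanSpace ℝ (Fin 3)) => ‖y‖) ⁻¹' I ∩
    {y | Real.sqrt (1 - θ ^ 2) * ‖y‖ < ⟪y, e⟫}

/-- Membership in the sector. [definition unfolding] -/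
theorem mem_sector {I : Set ℝ} {θ : ℝ} {y : (EuclideanSpace ℝ (Fin 3))} :
    y ∈ sector e I θ ↔ ‖y‖ ∈ I ∧ Real.sqrt (1 - θ ^ 2) * ‖y‖ < ⟪y, e⟫ := Iff.rfl

/-- The sector is measurable. [folklore] -/
theorem measurableSet_sector (e : (EuclideanSpace ℝ (Fin 3))) {I : Set ℝ} (hI : MeasurableSet I) (θ : ℝ) :
    MeasurableSet (sector e I θ) :=
  (measurable_norm hI).inter
    (measurableSet_lt (measurable_const.mul measurable_norm) (continuous_id.inner continuous_const).measurable)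

/-- COVER: a nonzero `y` in the closed `1/√3`-cone of `e` (`⟪y,e⟫ ≥ 0`, `⟪y,e⟫² ≥ ‖y‖²/3`) lies in the sector of
every aperture `θ` with `2/3 < θ² ≤ 1`. [folklore] -/
theorem mem_sector_of_inner_sq {I : Set ℝ} {θ : ℝ} (hθ : 2 / 3 < θ ^ 2) (hθ1 : θ ^ 2 ≤ 1)
    {y : (EuclideanSpace ℝ (Fin 3))} (hyI : ‖y‖ ∈ I) (hy0 : y ≠ 0) (hpos : 0 ≤ ⟪y, e⟫)
    (hcone : ‖y‖ ^ 2 / 3 ≤ ⟪y, e⟫ ^ 2) : y ∈ sector e I θ := by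
  refine ⟨hyI, ?_⟩
  have hn : 0 < ‖y‖ := norm_pos_iff.2 hy0
  have h1 : 0 ≤ 1 - θ ^ 2 := by linarith
  have hlt : (Real.sqrt (1 - θ ^ 2) * ‖y‖) ^ 2 < ⟪y, e⟫ ^ 2 := by
    rw [mul_pow, Real.sq_sqrt h1]
    have h13 : 1 - θ ^ 2 < 1 / 3 := by linarith
    have : (1 - θ ^ 2) * ‖y‖ ^ 2 < 1 / 3 * ‖y‖ ^ 2 := mul_lt_mul_of_pos_right h13 (pow_pos hn 2)
    linarith
  exact lt_of_pow_lt_pow_left₀ 2 hpos hlt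

/-- **Reverse cone Tonelli.**  For measurable `g ≥ 0`, a measurable set of positive radii `I` and an aperture
`0 < θ < 1`: `∫_{sector e I θ} g ≤ (1/√(1−θ²)) ∫_{t ∈ I} ∫_{‖z‖ < θt} g (sphereChart e e₁ e₂ t z) dz dt`.
(In frame coordinates `y = s e + z₁ e₁ + z₂ e₂` the sector is `{(s, z) : s = √(t² − ‖z‖²), t ∈ I, ‖z‖ < θt}`;
the substitution `s ↦ t` has Jacobian `t/s ≤ 1/√(1−θ²)` there.) [folklore: Tonelli + 1-D change of variables] -/
theorem lintegral_sector_le (hon : Orthonormal ℝ ![e, e₁, e₂]) {g : (EuclideanSpace ℝ (Fin 3)) → ℝ≥0∞}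
    (hg : Measurable g) {I : Set ℝ} (hI : MeasurableSet I) (hIpos : ∀ t ∈ I, 0 < t) {θ : ℝ} (hθ0 : 0 < θ)
    (hθ1 : θ < 1) :
    ∫⁻ y in sector e I θ, g y ≤ ENNReal.ofReal (1 / Real.sqrt (1 - θ ^ 2)) *
      ∫⁻ t in I, ∫⁻ z in ball (0 : ℂ) (θ * t), g (sphereChart e e₁ e₂ t z) := by
  have he : ‖e‖ = 1 := norm_frame₀ hon
  have h₁ : ‖e₁‖ = 1 := norm_frame₁ hon
  have h₂ : ‖e₂‖ = 1 := norm_frame₂ hon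
  have he1 : ⟪e, e₁⟫ = 0 := inner_frame₀₁ hon
  have he2 : ⟪e, e₂⟫ = 0 := inner_frame₀₂ hon
  have h12 : ⟪e₁, e₂⟫ = 0 := inner_frame₁₂ hon
  have hθ2 : 0 < 1 - θ ^ 2 := by nlinarith
  set κ : ℝ := Real.sqrt (1 - θ ^ 2) with hκ
  have hκ0 : 0 < κ := Real.sqrt_pos.2 hθ2
  have hκsq : κ ^ 2 = 1 - θ ^ 2 := Real.sq_sqrt hθ2.le
  -- frame coordinates
  set b : OrthonormalBasis (Fin 3) ℝ (EuclideanSpace ℝ (Fin 3)) := OrthonormalBasis.mk hon (top_le_span_frame hon)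
    with hbdef
  have hb : ⇑b = ![e, e₁, e₂] := OrthonormalBasis.coe_mk _ _
  have hb0 : b 0 = e := by rw [hb]; rfl
  have hb1 : b 1 = e₁ := by rw [hb]; rfl
  have hb2 : b 2 = e₂ := by rw [hb]; rfl
  set Ψ : ℝ × ℂ → (EuclideanSpace ℝ (Fin 3)) := ⇑b.repr.symm ∘ WithLp.toLp 2 ∘
    ⇑(MeasurableEquiv.piFinSuccAbove (fun _ : Fin 3 => ℝ) 0).symm ∘ Prod.map id ⇑Complex.measurableEquivPi with hΨdef
  have hΨ : MeasurePreserving Ψ := measurePreserving_frameCoords b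
  have hΨapply : ∀ (s : ℝ) (z : ℂ), Ψ (s, z) = discChart (s • e) e₁ e₂ z := by
    intro s z
    rw [hΨdef, frameCoords_apply, hb0, hb1, hb2]
  have hchart : ∀ (t : ℝ) (z : ℂ), sphereChart e e₁ e₂ t z = Ψ (capHeight t z, z) := by
    intro t z
    rw [hΨapply, sphereChart]
  -- geometry of the frame coordinates
  have hnormsq : ∀ (s : ℝ) (z : ℂ), ‖Ψ (s, z)‖ ^ 2 = s ^ 2 + ‖z‖ ^ 2 := by
    intro s z
    have hc1 : ⟪s • e, e₁⟫ = 0 := by rw [real_inner_smul_left, he1, mul_zero]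
    have hc2 : ⟪s • e, e₂⟫ = 0 := by rw [real_inner_smul_left, he2, mul_zero]
    rw [hΨapply, norm_discChart_sq h₁ h₂ h12 hc1 hc2, norm_smul, he, mul_one, Real.norm_eq_abs, sq_abs]
  have hinner : ∀ (s : ℝ) (z : ℂ), ⟪Ψ (s, z), e⟫ = s := by
    intro s z
    rw [hΨapply, show discChart (s • e) e₁ e₂ z = s • e + z.re • e₁ + z.im • e₂ from rfl, inner_add_left,
      inner_add_left, real_inner_smul_left, real_inner_smul_left, real_inner_smul_left,
      real_inner_self_eq_norm_sq, he, real_inner_comm e e₁, real_inner_comm e e₂, he1, he2]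
    ring
  -- the sector in frame coordinates: `s = capHeight t z` with `t ∈ I`, `‖z‖ < θ t`
  have hsec : ∀ (s : ℝ) (z : ℂ), Ψ (s, z) ∈ sector e I θ →
      s ∈ (fun t : ℝ => capHeight t z) '' {t | t ∈ I ∧ ‖z‖ < θ * t} := by
    intro s z hmem
    rw [mem_sector, hinner] at hmem
    obtain ⟨htI, hlt⟩ := hmem
    set t : ℝ := ‖Ψ (s, z)‖ with htdef
    have ht0 : 0 ≤ t := norm_nonneg _
    have hs0 : 0 < s := lt_of_le_of_lt (mul_nonneg hκ0.le ht0) hlt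
    have htsq : t ^ 2 = s ^ 2 + ‖z‖ ^ 2 := hnormsq s z
    have hzt : ‖z‖ < θ * t := by
      have h1 : κ ^ 2 * t ^ 2 < s ^ 2 := by
        have := hlt
        have h0 : 0 ≤ κ * t := mul_nonneg hκ0.le ht0
        nlinarith
      have h2 : ‖z‖ ^ 2 < (θ * t) ^ 2 := by rw [hκsq] at h1; nlinarith
      exact lt_of_pow_lt_pow_left₀ 2 (mul_nonneg hθ0.le ht0) h2
    refine ⟨t, ⟨htI, hzt⟩, ?_⟩
    show capHeight t z = s
    rw [capHeight, htsq, show s ^ 2 + ‖z‖ ^ 2 - ‖z‖ ^ 2 = s ^ 2 by ring, Real.sqrt_sq hs0.le]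
  -- the pulled-back integrand
  have hSm : MeasurableSet (sector e I θ) := measurableSet_sector e hI θ
  set G : ℝ × ℂ → ℝ≥0∞ := fun p => (sector e I θ).indicator g (Ψ p) with hGdef
  have hGm : Measurable G := (hg.indicator hSm).comp hΨ.measurable
  -- Step 1: pull back to frame coordinates and slice in `z`
  have step1 : ∫⁻ y in sector e I θ, g y = ∫⁻ z, ∫⁻ s, G (s, z) := by
    have hsw : AEMeasurable (Function.uncurry fun (z : ℂ) (s : ℝ) => G (s, z)) (volume.prod volume) :=
      (hGm.comp measurable_swap).aemeasurable
    calc ∫⁻ y in sector e I θ, g y = ∫⁻ y, (sector e I θ).indicator g y := (lintegral_indicator hSm _).symm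
      _ = ∫⁻ p : ℝ × ℂ, G p := (hΨ.lintegral_comp (hg.indicator hSm)).symm
      _ = ∫⁻ s, ∫⁻ z, G (s, z) := by
          rw [Measure.volume_eq_prod]
          exact lintegral_prod _ hGm.aemeasurable
      _ = ∫⁻ z, ∫⁻ s, G (s, z) := (lintegral_lintegral_swap hsw).symm
  -- Step 2: each `z`-fibre by the 1-D substitution with Jacobian `≤ 1/κ`
  have step2 : ∀ z : ℂ, ∫⁻ s, G (s, z) ≤
      ENNReal.ofReal (1 / κ) * ∫⁻ t in {t | t ∈ I ∧ ‖z‖ < θ * t}, g (sphereChart e e₁ e₂ t z) := by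
    intro z
    set R : Set ℝ := {t | t ∈ I ∧ ‖z‖ < θ * t} with hRdef
    have hRm : MeasurableSet R := hI.inter (measurableSet_lt measurable_const (measurable_id.const_mul θ))
    have hRz : ∀ t ∈ R, ‖z‖ < t := by
      intro t ht
      have ht0 := hIpos t ht.1
      calc ‖z‖ < θ * t := ht.2
        _ ≤ 1 * t := mul_le_mul_of_nonneg_right hθ1.le ht0.le
        _ = t := one_mul t
    have hderiv : ∀ t ∈ R, HasDerivWithinAt (fun t : ℝ => capHeight t z) (t / capHeight t z) R t :=
      fun t ht => (hasDerivAt_capHeight_radius (hRz t ht)).hasDerivWithinAt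
    have hinj := injOn_capHeight_radius z hRz
    -- `G (·, z)` is dominated by the indicator of the image
    have hdom : ∀ s, G (s, z) ≤ ((fun t : ℝ => capHeight t z) '' R).indicator (fun s => g (Ψ (s, z))) s := by
      intro s
      by_cases hmem : Ψ (s, z) ∈ sector e I θ
      · rw [hGdef]
        simp only
        rw [indicator_of_mem hmem, indicator_of_mem (hsec s z hmem)]
      · rw [hGdef]
        simp only
        rw [indicator_of_notMem hmem]
        exact bot_le
    -- Jacobian bound on the cone: `t / capHeight t z ≤ 1/κ`
    have hjac : ∀ t ∈ R, ENNReal.ofReal |t / capHeight t z| * g (Ψ (capHeight t z, z)) ≤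
        ENNReal.ofReal (1 / κ) * g (sphereChart e e₁ e₂ t z) := by
      intro t ht
      have ht0 := hIpos t ht.1
      have hzt := hRz t ht
      have hh := capHeight_pos hzt
      have hhκ : κ * t ≤ capHeight t z := by
        have h1 : (κ * t) ^ 2 ≤ capHeight t z ^ 2 := by
          rw [capHeight_sq hzt.le, mul_pow, hκsq]
          have h2 : ‖z‖ ^ 2 ≤ (θ * t) ^ 2 := pow_le_pow_left₀ (norm_nonneg _) ht.2.le 2
          nlinarith
        exact (pow_le_pow_iff_left₀ (by positivity) (capHeight_nonneg t z) two_ne_zero).1 h1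
      have hq : t / capHeight t z ≤ 1 / κ := by
        rw [div_le_div_iff₀ hh hκ0, one_mul]
        linarith
      have hq0 : 0 ≤ t / capHeight t z := div_nonneg ht0.le hh.le
      rw [abs_of_nonneg hq0, ← hchart]
      exact mul_le_mul_of_nonneg_right (ENNReal.ofReal_le_ofReal hq) bot_le
    calc ∫⁻ s, G (s, z) ≤ ∫⁻ s, ((fun t : ℝ => capHeight t z) '' R).indicator (fun s => g (Ψ (s, z))) s :=
          lintegral_mono hdom
      _ ≤ ∫⁻ s in (fun t : ℝ => capHeight t z) '' R, g (Ψ (s, z)) := lintegral_indicator_le _ _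
      _ = ∫⁻ t in R, ENNReal.ofReal |t / capHeight t z| * g (Ψ (capHeight t z, z)) :=
          lintegral_image_eq_lintegral_abs_deriv_mul hRm hderiv hinj _
      _ ≤ ∫⁻ t in R, ENNReal.ofReal (1 / κ) * g (sphereChart e e₁ e₂ t z) := setLIntegral_mono' hRm hjac
      _ = ENNReal.ofReal (1 / κ) * ∫⁻ t in R, g (sphereChart e e₁ e₂ t z) := by
          rw [lintegral_const_mul' _ _ ENNReal.ofReal_ne_top]
  -- Step 3: reassemble the cone integral
  set K : Set (ℝ × ℂ) := {p | p.1 ∈ I ∧ ‖p.2‖ < θ * p.1} with hKdef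
  have hKm : MeasurableSet K :=
    (measurable_fst hI).inter (measurableSet_lt continuous_snd.norm.measurable (measurable_fst.const_mul θ))
  set H : ℝ × ℂ → ℝ≥0∞ := K.indicator fun p => g (sphereChart e e₁ e₂ p.1 p.2) with hHdef
  have hHm : Measurable H := (hg.comp (continuous_sphereChart₂ e e₁ e₂).measurable).indicator hKm
  have step3 : ∀ z : ℂ, ∫⁻ t in {t | t ∈ I ∧ ‖z‖ < θ * t}, g (sphereChart e e₁ e₂ t z) = ∫⁻ t, H (t, z) := by
    intro z
    have hRm : MeasurableSet {t | t ∈ I ∧ ‖z‖ < θ * t} :=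
      hI.inter (measurableSet_lt measurable_const (measurable_id.const_mul θ))
    rw [← lintegral_indicator hRm]
    refine lintegral_congr fun t => ?_
    by_cases h : t ∈ I ∧ ‖z‖ < θ * t
    · have hK : (t, z) ∈ K := h
      have hR : t ∈ {t | t ∈ I ∧ ‖z‖ < θ * t} := h
      rw [hHdef, indicator_of_mem hK, indicator_of_mem hR]
    · have hK : (t, z) ∉ K := h
      have hR : t ∉ {t | t ∈ I ∧ ‖z‖ < θ * t} := h
      rw [hHdef, indicator_of_notMem hK, indicator_of_notMem hR]
  have step4 : ∫⁻ z, ∫⁻ t, H (t, z) = ∫⁻ t in I, ∫⁻ z in ball (0 : ℂ) (θ * t), g (sphereChart e e₁ e₂ t z) := by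
    have hsw : AEMeasurable (Function.uncurry fun (z : ℂ) (t : ℝ) => H (t, z)) (volume.prod volume) :=
      (hHm.comp measurable_swap).aemeasurable
    calc ∫⁻ z, ∫⁻ t, H (t, z) = ∫⁻ t, ∫⁻ z, H (t, z) := lintegral_lintegral_swap hsw
      _ = ∫⁻ t, I.indicator (fun t => ∫⁻ z in ball (0 : ℂ) (θ * t), g (sphereChart e e₁ e₂ t z)) t := by
          refine lintegral_congr fun t => ?_
          by_cases ht : t ∈ I
          · rw [indicator_of_mem ht, ← lintegral_indicator measurableSet_ball]
            refine lintegral_congr fun z => ?_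
            by_cases hz : z ∈ ball (0 : ℂ) (θ * t)
            · have hK : (t, z) ∈ K := ⟨ht, mem_ball_zero_iff.1 hz⟩
              rw [hHdef, indicator_of_mem hK, indicator_of_mem hz]
            · have hK : (t, z) ∉ K := fun h => hz (mem_ball_zero_iff.2 h.2)
              rw [hHdef, indicator_of_notMem hK, indicator_of_notMem hz]
          · rw [indicator_of_notMem ht]
            have h0 : ∀ z, H (t, z) = 0 := fun z => by
              have hK : (t, z) ∉ K := fun h => ht h.1
              rw [hHdef, indicator_of_notMem hK]
            simp [h0]
      _ = ∫⁻ t in I, ∫⁻ z in ball (0 : ℂ) (θ * t), g (sphereChart e e₁ e₂ t z) := lintegral_indicator hI _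
  -- assemble
  calc ∫⁻ y in sector e I θ, g y = ∫⁻ z, ∫⁻ s, G (s, z) := step1
    _ ≤ ∫⁻ z, ENNReal.ofReal (1 / κ) * ∫⁻ t in {t | t ∈ I ∧ ‖z‖ < θ * t}, g (sphereChart e e₁ e₂ t z) :=
        lintegral_mono step2
    _ = ENNReal.ofReal (1 / κ) * ∫⁻ z, ∫⁻ t, H (t, z) := by
        rw [← lintegral_const_mul' _ _ ENNReal.ofReal_ne_top]
        refine lintegral_congr fun z => ?_
        rw [step3 z]
    _ = ENNReal.ofReal (1 / κ) * ∫⁻ t in I, ∫⁻ z in ball (0 : ℂ) (θ * t), g (sphereChart e e₁ e₂ t z) := by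
        rw [step4]

end Summit.NavierStokesRegularity.NavierStokesRegularity.Theorems.PowerGaugeEulerLiouville.NeedleSectorTonelli
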